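import Summits.AnomalousDissipation.AnomalousDissipation.Theorems.EnsembleRigidityGPStatisticalRigidityWeakDuality
import HarnessLib

/-!
# Stub `stub_weakDuality2` (W2) of line `Sketch` (crux stmt-AnomalousDissipation-15508,
  `EnsembleRigidity.GPStatisticalRigidity`) — weak duality with the QUADRATIC roughness allowance

RESHAPE OF W (cycle 1 of the line). The first certificate shape of the line (stub W,
`stub_weakDuality`, landed) charged the roughness allowance `Λ⁻¹ ‖∇v‖ ‖∇Ψ'(v)‖`, linear in the
field amplitude along every ray `t u` that is invisible to the finitely many coordinates of `Ψ`
(`u ⊥ gᵢ`, so `Ψ'(t u) = Ψ'(0) =: h` is frozen) while the Reynolds stress `∫ ⟨(∇h) tu, tu⟩` is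
quadratic in `t`; by concentrating `u` near the point where `sym ∇h` is most negative this forces
`b ≥ sup_x λ_max(−sym ∇h(x)) ≥ ‖∇h‖₂/√12` and, with `a ≤ (f, h) ≤ ‖f‖_{Ḣ⁻¹} ‖∇h‖₂` (the inequality
at `v = 0`), kills every such family for `f_GP` above the level `√12 ‖f_GP‖_{Ḣ⁻¹} = 0.675…` (line
notes, cycle 1). The repaired shape — the Farkas-dual shape of "no admissible statistics of energy
`≤ E` and enstrophy `≤ G₀`" — charges roughness QUADRATICALLY and independently of the test:

  `a − b|v|² − Λ⁻¹ (1 + ‖∇v‖²) ≤ ⟨f − B(v,v), Ψ'(v)⟩`   at every finite-enstrophy `v ∈ H`,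

so that concentration is paid for by enstrophy (the region where the left side is positive is
`L²`-compact by Rellich). This file proves the corresponding weak duality, which is EASIER than W:
the allowance integrates to `Λ⁻¹(1 + G)` directly, no Cauchy–Schwarz being needed for it.

## Proof

Given `μ` (probability, integrable energy `≤ E`, mean enstrophy `G < ∞`, defect `≤ R ≤ δ₀` against
every cylindrical `Φ`), choose `Λ := 2(1+G)/γ` after seeing `μ`, take `Ψ, a, b` from the family,
integrate the pointwise inequality (`μ`-a.e., finite enstrophy a.e.): `a − b∫|v|² − Λ⁻¹(1+G) ≤
∫ ⟨f − B(v,v), Ψ'(v)⟩ dμ ≤ R X ≤ R C √(1+G)` (`X² = ∫‖∇Ψ'(v)‖² dμ ≤ C²(1+G)` by the cost clause),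
so `γ/2 ≤ R C √(1+G)`; the endgame `γ/(4C) ≤ R√G` (cases `G ≥ 1` / `G < 1`) is the one of W.

## References

* C. Foias, O. Manley, R. Rosa, R. Temam, *Navier–Stokes Equations and Turbulence* (CUP 2001),
  Ch. IV §1.2 Def. 1.3, (1.29)–(1.31).
* R. Rosa, R. Temam, arXiv:2010.06730 (auxiliary functionals / minimax for statistical solutions).
* I. Tobasco, D. Goluskin, C. Doering, arXiv:1705.07096 (sharpness of auxiliary-functional bounds on
  compact phase spaces — the compactness the quadratic allowance restores).
-/

-- `Summit.<Summit>.<Problem>` is the tree's mandated summit-side namespace (CONVENTIONS §2); single-conjunct summit, duplicate deliberate.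
set_option linter.dupNamespace false

noncomputable section

namespace Summit.AnomalousDissipation.AnomalousDissipation.Theorems.EnsembleRigidity.GPStatisticalRigidity

open MeasureTheory Filter Topology UnitAddTorus
open scoped InnerProductSpace RealInnerProductSpace ENNReal NNReal
open Literature.Analysis.FunctionSpaces Literature.Analysis.FluidPDE
open Summit.AnomalousDissipation.AnomalousDissipation.Theorems.EnsembleRigidity

/-- Local notation: real vector fields on `T³`. -/
local notation "Vec3" => (UnitAddTorus (Fin 3)) → (EuclideanSpace ℝ (Fin 3))
/-- Local notation: `L²(T³; ℝ³)`. -/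
local notation "L2" => (Lp (EuclideanSpace ℝ (Fin 3)) 2 (volume : Measure (UnitAddTorus (Fin 3))))
/-- Local notation: the energy space `H`. -/
local notation "H3" => (Torus.energySpace (Fin 3))

/-- **Integrated certificate inequality, quadratic allowance.** For a probability measure `μ` on `H`
with integrable energy and finite mean enstrophy `G`, a cylindrical `Ψ` with cost
`‖∇Ψ'(v)‖² ≤ C²(1 + ‖∇v‖²)`, the pointwise inequality `a − b|v|² − Λ⁻¹(1 + ‖∇v‖²) ≤ ⟨f − B(v,v), Ψ'(v)⟩`
at finite-enstrophy `v`, and the defect bound `|∫ ⟨f − B(v,v), Ψ'(v)⟩ dμ| ≤ R (∫‖∇Ψ'(v)‖² dμ)^{1/2}`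
(integrand integrable), one has `a − b ∫|v|² dμ − Λ⁻¹ (1 + G) ≤ R · C √(1+G)`. [folklore] -/
theorem weakDuality2_integrate (f : Vec3) (μ : Measure H3) [IsProbabilityMeasure μ]
    (hint : Integrable (fun v : H3 => ‖v‖ ^ 2) μ) (hGfin : Torus.ensembleEnstrophy μ < ⊤)
    (Ψ : Torus.CylindricalTest (Fin 3)) {a b Λ C R : ℝ} (hC : 0 < C) (hR : 0 ≤ R)
    (hcost : ∀ v : H3, Torus.gradNormSq (Ψ.grad v) ≤
        C ^ 2 * (1 + (Torus.eGradNormSq ((v : L2) : Vec3)).toReal))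
    (hcert : ∀ v : H3, Torus.eGradNormSq ((v : L2) : Vec3) ≠ ⊤ →
        a - b * ‖v‖ ^ 2 - Λ⁻¹ * (1 + (Torus.eGradNormSq ((v : L2) : Vec3)).toReal) ≤
          Torus.nsGeneratorPairing 0 f v (Ψ.grad v))
    (hdefI : Integrable (fun v : H3 => Torus.nsGeneratorPairing 0 f v (Ψ.grad v)) μ)
    (hdef : |∫ v, Torus.nsGeneratorPairing 0 f v (Ψ.grad v) ∂μ| ≤
              R * Real.sqrt (∫ v, Torus.gradNormSq (Ψ.grad v) ∂μ)) :
    a - b * Torus.ensembleEnergy μ - Λ⁻¹ * (1 + (Torus.ensembleEnstrophy μ).toReal) ≤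
      R * (C * Real.sqrt (1 + (Torus.ensembleEnstrophy μ).toReal)) := by
  -- (1) the enstrophy density: measurable, finite a.e., integrable, of integral `G`
  have hGm : Measurable fun u : H3 => Torus.eGradNormSq ((u : L2) : Vec3) :=
    Torus.measurable_eGradNormSq_coe
  have hGlt : ∀ᵐ u : H3 ∂μ, Torus.eGradNormSq ((u : L2) : Vec3) < ⊤ := ae_lt_top hGm hGfin.ne
  have haI : Integrable (fun u : H3 => (Torus.eGradNormSq ((u : L2) : Vec3)).toReal) μ :=
    integrable_toReal_of_lintegral_ne_top hGm.aemeasurable hGfin.ne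
  have hGa : ∫ u : H3, (Torus.eGradNormSq ((u : L2) : Vec3)).toReal ∂μ =
      (Torus.ensembleEnstrophy μ).toReal := by
    rw [Torus.ensembleEnstrophy, integral_toReal hGm.aemeasurable hGlt]
  -- (2) the test enstrophy: continuous and bounded on `H`, hence integrable; `X ≤ C √(1+G)`
  obtain ⟨hbc, C', hC'⟩ := ResidualTransferSSS.stub_testEnstrophyTame Ψ
  have hbI : Integrable (fun u : H3 => Torus.gradNormSq (Ψ.grad u)) μ := by
    refine Integrable.mono' (integrable_const (max C' 0)) hbc.aestronglyMeasurable
      (ae_of_all _ fun u => ?_)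
    rw [Real.norm_of_nonneg (Torus.gradNormSq_nonneg _)]
    exact (hC' u).trans (le_max_left _ _)
  have hX : Real.sqrt (∫ u, Torus.gradNormSq (Ψ.grad u) ∂μ) ≤
      C * Real.sqrt (1 + (Torus.ensembleEnstrophy μ).toReal) := by
    have h1 : Integrable
        (fun u : H3 => C ^ 2 * (1 + (Torus.eGradNormSq ((u : L2) : Vec3)).toReal)) μ :=
      ((integrable_const (1 : ℝ)).add haI).const_mul (C ^ 2)
    have h2 : ∫ u, Torus.gradNormSq (Ψ.grad u) ∂μ ≤
        C ^ 2 * (1 + (Torus.ensembleEnstrophy μ).toReal) := by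
      calc ∫ u, Torus.gradNormSq (Ψ.grad u) ∂μ
          ≤ ∫ u : H3, C ^ 2 * (1 + (Torus.eGradNormSq ((u : L2) : Vec3)).toReal) ∂μ :=
            integral_mono hbI h1 fun u => hcost u
        _ = C ^ 2 * (1 + (Torus.ensembleEnstrophy μ).toReal) := by
            rw [integral_const_mul, integral_add (integrable_const _) haI, integral_const, hGa,
              probReal_univ, one_smul]
    calc Real.sqrt (∫ u, Torus.gradNormSq (Ψ.grad u) ∂μ)
        ≤ Real.sqrt (C ^ 2 * (1 + (Torus.ensembleEnstrophy μ).toReal)) := Real.sqrt_le_sqrt h2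
      _ = C * Real.sqrt (1 + (Torus.ensembleEnstrophy μ).toReal) := by
          rw [Real.sqrt_mul (sq_nonneg C), Real.sqrt_sq hC.le]
  -- (3) integrate the pointwise certificate inequality (valid `μ`-a.e.)
  have hae : ∀ᵐ v : H3 ∂μ,
      a - b * ‖v‖ ^ 2 - Λ⁻¹ * (1 + (Torus.eGradNormSq ((v : L2) : Vec3)).toReal) ≤
        Torus.nsGeneratorPairing 0 f v (Ψ.grad v) := by
    filter_upwards [hGlt] with v hv
    exact hcert v hv.ne
  have hL1 : Integrable (fun v : H3 => a - b * ‖v‖ ^ 2) μ :=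
    (integrable_const a).sub (hint.const_mul b)
  have hL2 : Integrable (fun v : H3 =>
      Λ⁻¹ * (1 + (Torus.eGradNormSq ((v : L2) : Vec3)).toReal)) μ :=
    ((integrable_const (1 : ℝ)).add haI).const_mul _
  have hLint : Integrable (fun v : H3 =>
      a - b * ‖v‖ ^ 2 - Λ⁻¹ * (1 + (Torus.eGradNormSq ((v : L2) : Vec3)).toReal)) μ := hL1.sub hL2
  have hmono := integral_mono_ae hLint hdefI hae
  rw [integral_sub hL1 hL2, integral_sub (integrable_const a) (hint.const_mul b), integral_const,
    probReal_univ, one_smul, integral_const_mul, integral_const_mul,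
    integral_add (integrable_const _) haI, integral_const, probReal_univ, one_smul, hGa] at hmono
  have hdef' : ∫ v, Torus.nsGeneratorPairing 0 f v (Ψ.grad v) ∂μ ≤
      R * Real.sqrt (∫ v, Torus.gradNormSq (Ψ.grad v) ∂μ) := (le_abs_self _).trans hdef
  -- (4) combine
  have h4 : R * Real.sqrt (∫ u, Torus.gradNormSq (Ψ.grad u) ∂μ) ≤
      R * (C * Real.sqrt (1 + (Torus.ensembleEnstrophy μ).toReal)) :=
    mul_le_mul_of_nonneg_left hX hR
  unfold Torus.ensembleEnergy
  linarith [hmono, hdef', h4]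

/-- **Arithmetic endgame, quadratic allowance.** From `γ ≤ a − bE`, `b ≥ 0`, `∫|v|² ≤ E` and the
integrated inequality at the roughness scale `Λ⁻¹ = γ/(2(1+G))`,
`a − b∫|v|² − γ/2 ≤ R C √(1+G)`, one gets `γ/2 ≤ R C √(1+G)` and hence `γ/(4C) ≤ R √G`
(`G ≥ 1`: `√(1+G) ≤ 2√G`; `G < 1`: `√(1+G) < 2` contradicts `R ≤ γ/(4C)`). [folklore] -/
theorem weakDuality2_arith {γ C R G En E a b : ℝ} (hγ : 0 < γ) (hC : 0 < C) (hR : 0 ≤ R)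
    (hRδ : R ≤ γ / (4 * C)) (hG : 0 ≤ G) (hb : 0 ≤ b) (hab : γ ≤ a - b * E) (hEn : En ≤ E)
    (hcore : a - b * En - γ / (2 * (1 + G)) * (1 + G) ≤ R * (C * Real.sqrt (1 + G))) :
    γ / (4 * C) ≤ R * Real.sqrt G := by
  have hs2 : Real.sqrt G ^ 2 = G := Real.sq_sqrt hG
  have hT : γ / (2 * (1 + G)) * (1 + G) = γ / 2 := by
    field_simp
  have hEn' : b * En ≤ b * E := mul_le_mul_of_nonneg_left hEn hb
  have key : γ / 2 ≤ R * C * Real.sqrt (1 + G) := by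
    rw [hT] at hcore
    linarith
  by_cases hG1 : 1 ≤ G
  · -- `√(1+G) ≤ 2√G`
    have hS : Real.sqrt (1 + G) ≤ 2 * Real.sqrt G := by
      rw [Real.sqrt_le_left (by positivity), mul_pow, hs2]
      linarith
    have h2 : R * C * Real.sqrt (1 + G) ≤ R * C * (2 * Real.sqrt G) :=
      mul_le_mul_of_nonneg_left hS (mul_nonneg hR hC.le)
    rw [div_le_iff₀ (by positivity)]
    linarith
  · -- `√(1+G) < 2` forces `R > γ/(4C)`, excluded
    rw [not_le] at hG1
    have hS : Real.sqrt (1 + G) < 2 := by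
      rw [Real.sqrt_lt' (by norm_num : (0 : ℝ) < 2)]
      linarith
    have h3 : R * (4 * C) ≤ γ := (le_div_iff₀ (by positivity)).1 hRδ
    rcases hR.eq_or_lt with h0 | hpos
    · rw [← h0, zero_mul, zero_mul] at key
      linarith
    · have h2 : R * C * Real.sqrt (1 + G) < R * C * 2 :=
        mul_lt_mul_of_pos_left hS (mul_pos hpos hC)
      linarith

/-- **W2 `stub_weakDuality2`** — WEAK DUALITY WITH THE QUADRATIC ROUGHNESS ALLOWANCE (reshape of W;
idea `odd-lyapunov-certificate-family`, Farkas-dual shape). If for every roughness scale `Λ > 0`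
there is a cylindrical certificate `Ψ_Λ` with cost `‖∇Ψ_Λ'(v)‖² ≤ C²(1 + ‖∇v‖²)` and the pointwise
forced-Euler Lyapunov inequality `a − b|v|² − Λ⁻¹(1 + ‖∇v‖²) ≤ ⟨f − B(v,v), Ψ_Λ'(v)⟩` on
finite-enstrophy fields, `b ≥ 0`, `a − bE ≥ γ > 0` (`γ, C` uniform in `Λ`), then every probability
measure on `H` with integrable energy `≤ E`, finite mean enstrophy `G` and cylindrical forced-Euler
defect `≤ R ≤ δ₀` pays `c ≤ R √G`, with `c = δ₀ = γ/(4C)` (choose `Λ = 2(1+G)/γ` after seeing `μ`). [folklore] -/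
theorem stub_weakDuality2 (f : Vec3) (E γ C : ℝ) (hγ : 0 < γ) (hC : 0 < C)
    (hfam : ∀ Λ : ℝ, 0 < Λ → ∃ (Ψ : Torus.CylindricalTest (Fin 3)) (a b : ℝ), 0 ≤ b ∧ γ ≤ a - b * E ∧
      (∀ v : H3, Torus.gradNormSq (Ψ.grad v) ≤
        C ^ 2 * (1 + (Torus.eGradNormSq ((v : L2) : Vec3)).toReal)) ∧
      (∀ v : H3, Torus.eGradNormSq ((v : L2) : Vec3) ≠ ⊤ →
        a - b * ‖v‖ ^ 2 - Λ⁻¹ * (1 + (Torus.eGradNormSq ((v : L2) : Vec3)).toReal) ≤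
          Torus.nsGeneratorPairing 0 f v (Ψ.grad v))) :
    ∃ c δ₀ : ℝ, 0 < c ∧ 0 < δ₀ ∧ ∀ μ : Measure H3, IsProbabilityMeasure μ →
      Integrable (fun v : H3 => ‖v‖ ^ 2) μ → Torus.ensembleEnergy μ ≤ E → Torus.ensembleEnstrophy μ < ⊤ →
      ∀ R : ℝ, 0 ≤ R → R ≤ δ₀ →
        (∀ Φ : Torus.CylindricalTest (Fin 3),
          Integrable (fun v : H3 => Torus.nsGeneratorPairing 0 f v (Φ.grad v)) μ ∧
            |∫ v, Torus.nsGeneratorPairing 0 f v (Φ.grad v) ∂μ| ≤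
              R * Real.sqrt (∫ v, Torus.gradNormSq (Φ.grad v) ∂μ)) →
        c ≤ R * Real.sqrt (Torus.ensembleEnstrophy μ).toReal := by
  refine ⟨γ / (4 * C), γ / (4 * C), by positivity, by positivity, ?_⟩
  intro μ hμ hint hEμ hGfin R hR0 hRδ hdef
  -- the roughness scale `Λ := 2(1+G)/γ` is chosen after seeing `μ`
  have hG0 : 0 ≤ (Torus.ensembleEnstrophy μ).toReal := ENNReal.toReal_nonneg
  have hΛ : 0 < (γ / (2 * (1 + (Torus.ensembleEnstrophy μ).toReal)))⁻¹ := by positivity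
  obtain ⟨Ψ, a, b, hb, hab, hcost, hcert⟩ := hfam _ hΛ
  obtain ⟨hdefI, hdefΨ⟩ := hdef Ψ
  have hcore := weakDuality2_integrate f μ hint hGfin Ψ hC hR0 hcost hcert hdefI hdefΨ
  rw [inv_inv] at hcore
  exact weakDuality2_arith (E := E) hγ hC hR0 hRδ hG0 hb hab hEμ hcore

end Summit.AnomalousDissipation.AnomalousDissipation.Theorems.EnsembleRigidity.GPStatisticalRigidity

end
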